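import Summits.BirchSwinnertonDyer.BirchSwinnertonDyer.Theorems.KolyvaginRankRigidityAtTwoChebotarevPairAtTwo
import Summits.BirchSwinnertonDyer.BirchSwinnertonDyer.Theorems.KolyvaginRankRigidityAtTwoChebotarevHabitatAtTwo
import HarnessLib

/-!
# Crux V2♭ `KolyvaginCorankLowerBoundAtTwo` (stmt-BirchSwinnertonDyer-24623), line `kolyvagin_depth_split`,
# window step T5b of the lead's skeleton: NEW WINDOW PRIMES AT `2` ON THE HABITAT
# (helper, PROVED, unconditional; width seat `bsd-line-krr2-p2` g6)

Assembly of the seat's Čebotarev-at-`2` chain in the binders of V2♭'s habitat (`W` globally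
minimal with surjective `2`-adic tower, `K` imaginary quadratic with `2 ∤ d_K` and the Heegner
hypothesis for `N_E`; the binder `d_K·Δ_E ∉ ℚ^{×2}` is discharged by
`not_isSquare_discr_mul_Δ_of_heegner`) and in ORDER-FREE form (no exponent bookkeeping for the
caller: "local order ≥ global order / 4"):

* `exists_kolyvaginPrime_notMem_of_heegner` — for ONE class `κ ∈ H¹(K, E[2^M])` with
  `c_* κ = ε κ` (`ε = ±1`; for `κ = c_M(n)` this is the landed T3 `stub_conjSign`), any `M' ≥ M`
  (the lead's margin is `M' = M + 1`) and any finite set `S` of naturals: a Kolyvagin prime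
  `q ∉ S` at `2` with `M' ≤ M(q)` and a place `v ∋ q` of `K` with
  **`2^{j+2} κ ≠ 0 ⟹ 2^j κ ∉ ker (H¹(K, E[2^M]) → H¹(K_v, E[2^M]))`** for every `j`;
* `exists_kolyvaginPrime_notMem_pair_of_heegner` — the same for TWO eigenclasses `κ₁, κ₂` at once
  (the window-replacement shape: `loc_q c(n)` large AND `loc_q c` large for the auxiliary class).

In the currency of the lead's `h5b` (`2^{e'} c ≠ 0` for `e' + e < M`): for `e' + e + 2 < M` the
hypothesis gives `2^{e'+2} c ≠ 0`, hence `2^{e'} c ∉ ker loc_v` — defect `D = 2`.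
HONEST FRAMING: helper (`--supports` 24623); this is the Čebotarev half (a′) of the window step
ONLY — the duality half (a new datum `c(q·∏(S∖a))` of large order: McCallum Lemma 5.3 /
Prop. 2.1–2.2 at `2` + the Kolyvagin relation Q2) is not touched; T5⁺ and V2♭ are NOT proved; BSD
is not proved by any of this.

References: [McCallumLMS1991] §3 Cor. 3.2, §5 (proof of Prop. 5.2); [Kolyvagin1991MathAnn] §2
(proof of Thm. 2.2; ref. [1] Prop. 8); [GrossLMS1991] §3 (3.1)–(3.3), §9; [WZhang2014] Notations (xii).
-/

set_option autoImplicit false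
-- the Theorems namespace of this sub repeats the summit name by design (D-0017 nested layout)
set_option linter.dupNamespace false

noncomputable section

open scoped Classical

namespace Summit.BirchSwinnertonDyer.BirchSwinnertonDyer.Theorems.KolyvaginLowerBoundAtTwo

open WeierstrassCurve Field NumberField IsDedekindDomain
open Literature.NumberTheory.GaloisRepresentations Literature.NumberTheory.EllipticCurves
open Literature.NumberTheory

section WindowPrime

variable (W : WeierstrassCurve ℚ) (K : Type) [Field K] [NumberField K]

/-- From the exponent of a class to the order-free local statement: if `2^{m-1} κ ≠ 0`, `2^m κ = 0`
and `2^j κ ∉ ker` for `j + 3 ≤ m`, then `2^{j+2} κ ≠ 0 ⟹ 2^j κ ∉ ker`. [folklore] -/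
theorem orderFree_of_exponent {M : ℕ} {κ : galH1Torsion (W.baseChange K) ((2 ^ M : ℕ) : ℤ)}
    {m : ℕ} (hkill : (2 : ℤ) ^ m • κ = 0) {P : ℕ → Prop} (hP : ∀ j : ℕ, j + 3 ≤ m → P j) :
    ∀ j : ℕ, ((2 ^ (j + 2) : ℕ) : ℤ) • κ ≠ 0 → P j := by
  intro j hj
  apply hP
  by_contra hlt
  apply hj
  have : ((2 ^ (j + 2) : ℕ) : ℤ) • κ = (2 : ℤ) ^ (j + 2 - m) • ((2 : ℤ) ^ m • κ) := by
    rw [smul_smul, ← pow_add, Nat.sub_add_cancel (by omega)]; push_cast; rfl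
  rw [this, hkill, zsmul_zero]

/-- The `2`-exponent of a non-zero class of `H¹(K, E[2^M])`. [folklore] -/
theorem exists_exponent_two {M : ℕ} {κ : galH1Torsion (W.baseChange K) ((2 ^ M : ℕ) : ℤ)}
    (hκ0 : κ ≠ 0) : ∃ m : ℕ, (2 : ℤ) ^ m • κ = 0 ∧ (2 : ℤ) ^ (m - 1) • κ ≠ 0 := by
  obtain ⟨m, -, -, hkill, hne, -⟩ := exists_addOrderOf_eq_pow (W.baseChange K) Nat.prime_two M hκ0
  exact ⟨m, by exact_mod_cast hkill, by exact_mod_cast hne⟩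

/-- **New window prime at `2` for ONE eigenclass, on the habitat, order-free.** See the module
docstring. [cite: McCallumLMS1991, §3 Cor. 3.2] [cite: Kolyvagin1991MathAnn, §2 (ref. [1] Prop. 8)]
[cite: WZhang2014, Notations (xii)] -/
theorem exists_kolyvaginPrime_notMem_of_heegner [W.IsElliptic] [W.IsGloballyMinimal]
    (hρ : ∀ n : ℕ, W.HasSurjectiveModNGaloisRep (2 ^ n : ℕ)) (hK : IsImaginaryQuadratic K)
    (h2d : ¬ ((2 : ℤ) ∣ NumberField.discr K)) [NeZero (W.conductorNorm ℤ)]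
    (hH : SatisfiesHeegnerHypothesis (W.conductorNorm ℤ) K) {c : K ≃ₐ[ℚ] K} (hc : c ≠ 1)
    {M M' : ℕ} (hM : 1 ≤ M) (hMM' : M ≤ M')
    (κ : galH1Torsion (W.baseChange K) ((2 ^ M : ℕ) : ℤ)) {ε : ℤ} (hε : ε = 1 ∨ ε = -1)
    (hκ : conjAct W c ((2 ^ M : ℕ) : ℤ) κ = ε • κ) (S : Finset ℕ) :
    ∃ q : ℕ, q ∉ S ∧ Zhang2014.IsKolyvaginPrime (W.conductorNorm ℤ) W K 2 q ∧
      M' ≤ Zhang2014.kolyvaginIndex W 2 q ∧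
      ∃ v : HeightOneSpectrum (𝓞 K), ((q : ℕ) : 𝓞 K) ∈ v.asIdeal ∧
        ∀ j : ℕ, ((2 ^ (j + 2) : ℕ) : ℤ) • κ ≠ 0 →
          ((2 ^ j : ℕ) : ℤ) • κ ∉
            (W.baseChange K).torsionLocalKer (v.adicCompletion K) ((2 ^ M : ℕ) : ℤ) := by
  classical
  have hM' : 1 ≤ M' := hM.trans hMM'
  by_cases hκ0 : κ = 0
  · -- nothing to localise: any Kolyvagin prime of index `≥ M'` outside `S`
    obtain ⟨q, hbq, hkoly, hidx, -⟩ := exists_kolyvaginPrime_gt_le_kolyvaginIndex (W := W)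
      (N := W.conductorNorm ℤ) hK hc hM' (S.sup id)
    have hqS : q ∉ S := fun h ↦ by
      have := Finset.le_sup (f := id) h
      simp only [id_eq] at this
      omega
    obtain ⟨v, hv⟩ := exists_natCast_mem_of_isKolyvaginPrime (W := W) hkoly
    refine ⟨q, hqS, hkoly, hidx, v, hv, fun j hj ↦ absurd ?_ hj⟩
    rw [hκ0, zsmul_zero]
  · obtain ⟨m, hkill, hm⟩ := exists_exponent_two W K hκ0
    have hns := not_isSquare_discr_mul_Δ_of_heegner W (by simpa using hρ 1) hK h2d hH
    have hinf := setInfinite_kolyvaginPrime_two_eigenclass_of_le (N := W.conductorNorm ℤ) hK hns hρ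
      hc hM hMM' κ hε hκ hm
    obtain ⟨q, hq⟩ := (hinf.sdiff S.finite_toSet).nonempty
    obtain ⟨⟨hkoly, hidx, -, hloc⟩, hqS⟩ := hq
    obtain ⟨v, hv⟩ := exists_natCast_mem_of_isKolyvaginPrime (W := W) hkoly
    exact ⟨q, hqS, hkoly, hidx, v, hv,
      orderFree_of_exponent W K hkill (fun j hj ↦ hloc v hv j hj)⟩

/-- **New window prime at `2` for TWO eigenclasses at once, on the habitat, order-free** (the
window-replacement shape of McCallum's proof of Prop. 5.2 / Kolyvagin's Prop. 8: the new prime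
sees both the current class and the auxiliary class). [cite: McCallumLMS1991, §5 (proof of
Prop. 5.2)] [cite: Kolyvagin1991MathAnn, §2 (ref. [1] Prop. 8)] -/
theorem exists_kolyvaginPrime_notMem_pair_of_heegner [W.IsElliptic] [W.IsGloballyMinimal]
    (hρ : ∀ n : ℕ, W.HasSurjectiveModNGaloisRep (2 ^ n : ℕ)) (hK : IsImaginaryQuadratic K)
    (h2d : ¬ ((2 : ℤ) ∣ NumberField.discr K)) [NeZero (W.conductorNorm ℤ)]
    (hH : SatisfiesHeegnerHypothesis (W.conductorNorm ℤ) K) {c : K ≃ₐ[ℚ] K} (hc : c ≠ 1)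
    {M M' : ℕ} (hM : 1 ≤ M) (hMM' : M ≤ M')
    (κ₁ κ₂ : galH1Torsion (W.baseChange K) ((2 ^ M : ℕ) : ℤ)) {ε₁ ε₂ : ℤ}
    (hε₁ : ε₁ = 1 ∨ ε₁ = -1) (hε₂ : ε₂ = 1 ∨ ε₂ = -1)
    (hκ₁ : conjAct W c ((2 ^ M : ℕ) : ℤ) κ₁ = ε₁ • κ₁)
    (hκ₂ : conjAct W c ((2 ^ M : ℕ) : ℤ) κ₂ = ε₂ • κ₂) (S : Finset ℕ) :
    ∃ q : ℕ, q ∉ S ∧ Zhang2014.IsKolyvaginPrime (W.conductorNorm ℤ) W K 2 q ∧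
      M' ≤ Zhang2014.kolyvaginIndex W 2 q ∧
      ∃ v : HeightOneSpectrum (𝓞 K), ((q : ℕ) : 𝓞 K) ∈ v.asIdeal ∧
        (∀ j : ℕ, ((2 ^ (j + 2) : ℕ) : ℤ) • κ₁ ≠ 0 →
          ((2 ^ j : ℕ) : ℤ) • κ₁ ∉
            (W.baseChange K).torsionLocalKer (v.adicCompletion K) ((2 ^ M : ℕ) : ℤ)) ∧
        (∀ j : ℕ, ((2 ^ (j + 2) : ℕ) : ℤ) • κ₂ ≠ 0 →
          ((2 ^ j : ℕ) : ℤ) • κ₂ ∉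
            (W.baseChange K).torsionLocalKer (v.adicCompletion K) ((2 ^ M : ℕ) : ℤ)) := by
  classical
  -- if one class is zero, the one-class theorem for the other does it
  by_cases h1 : κ₁ = 0
  · obtain ⟨q, hqS, hkoly, hidx, v, hv, hloc⟩ :=
      exists_kolyvaginPrime_notMem_of_heegner W K hρ hK h2d hH hc hM hMM' κ₂ hε₂ hκ₂ S
    refine ⟨q, hqS, hkoly, hidx, v, hv, fun j hj ↦ absurd ?_ hj, hloc⟩
    rw [h1, zsmul_zero]
  by_cases h2 : κ₂ = 0
  · obtain ⟨q, hqS, hkoly, hidx, v, hv, hloc⟩ :=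
      exists_kolyvaginPrime_notMem_of_heegner W K hρ hK h2d hH hc hM hMM' κ₁ hε₁ hκ₁ S
    refine ⟨q, hqS, hkoly, hidx, v, hv, hloc, fun j hj ↦ absurd ?_ hj⟩
    rw [h2, zsmul_zero]
  obtain ⟨m₁, hkill₁, hm₁⟩ := exists_exponent_two W K h1
  obtain ⟨m₂, hkill₂, hm₂⟩ := exists_exponent_two W K h2
  have hns := not_isSquare_discr_mul_Δ_of_heegner W (by simpa using hρ 1) hK h2d hH
  obtain ⟨q, hbq, hkoly, hidx, -, hloc⟩ := exists_kolyvaginPrime_gt_two_eigenclass_pair_of_le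
    (N := W.conductorNorm ℤ) hK hns hρ hc hM hMM' κ₁ κ₂ hε₁ hε₂ hκ₁ hκ₂ hm₁ hm₂ (S.sup id)
  have hqS : q ∉ S := fun h ↦ by
    have := Finset.le_sup (f := id) h
    simp only [id_eq] at this
    omega
  obtain ⟨v, hv⟩ := exists_natCast_mem_of_isKolyvaginPrime (W := W) hkoly
  exact ⟨q, hqS, hkoly, hidx, v, hv,
    orderFree_of_exponent W K hkill₁ (fun j hj ↦ (hloc v hv).1 j hj),
    orderFree_of_exponent W K hkill₂ (fun j hj ↦ (hloc v hv).2 j hj)⟩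

end WindowPrime

/-! ### Eigenclass production: `(1 ± τ)`-symmetrisation (one more bit) -/

section Symmetrise

variable {k : Type} {K : Type} [Field k] [Field K] [Algebra k K] (V : WeierstrassCurve k)
  {σ : K ≃ₐ[k] K}

/-- **`y + σ_* y` is a `(+1)`-eigenclass and `y - σ_* y` a `(-1)`-eigenclass** for an involution
`σ` (e.g. complex conjugation of an imaginary quadratic `K`). At odd `p` one would project onto the
eigenspaces; at `2` one symmetrises. [cite: GrossLMS1991, §5 (5.1)] -/
theorem conjAct_add_conjAct_eq (hσ : σ * σ = 1) (n : ℤ) (y : galH1Torsion (V.baseChange K) n) :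
    conjAct V σ n (y + conjAct V σ n y) = (1 : ℤ) • (y + conjAct V σ n y) ∧
      conjAct V σ n (y - conjAct V σ n y) = (-1 : ℤ) • (y - conjAct V σ n y) := by
  constructor
  · rw [map_add, conjAct_conjAct_of_mul_self V hσ, one_zsmul, add_comm]
  · rw [map_sub, conjAct_conjAct_of_mul_self V hσ, neg_one_zsmul, neg_sub]

/-- **Symmetrisation loses at most one bit of order**: if `2^m y ≠ 0` then one of `y + σ_* y`,
`y - σ_* y` satisfies `2^{m-1} · (…) ≠ 0` (their sum is `2y`). So from ANY class of order `≥ 2^{m+1}`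
one gets an EIGENclass of order `≥ 2^m`, of either sign — the input shape of the Čebotarev-at-`2`
theorems. [folklore] -/
theorem exists_sign_pow_smul_symmetrise_ne_zero (hσ : σ * σ = 1) (n : ℤ)
    (y : galH1Torsion (V.baseChange K) n) {m : ℕ} (hm : 1 ≤ m) (hy : (2 : ℤ) ^ m • y ≠ 0) :
    ∃ ε : ℤ, (ε = 1 ∨ ε = -1) ∧
      conjAct V σ n (y + ε • conjAct V σ n y) = ε • (y + ε • conjAct V σ n y) ∧
      (2 : ℤ) ^ (m - 1) • (y + ε • conjAct V σ n y) ≠ 0 := by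
  obtain ⟨hplus, hminus⟩ := conjAct_add_conjAct_eq V hσ n y
  by_cases h : (2 : ℤ) ^ (m - 1) • (y + conjAct V σ n y) = 0
  · refine ⟨-1, Or.inr rfl, ?_, ?_⟩
    · rw [neg_one_zsmul, ← sub_eq_add_neg]; exact hminus
    · intro h'
      apply hy
      rw [neg_one_zsmul, ← sub_eq_add_neg] at h'
      have hsum : (y + conjAct V σ n y) + (y - conjAct V σ n y) = (2 : ℤ) • y := by
        rw [two_zsmul]; abel
      have e : (2 : ℤ) ^ m = (2 : ℤ) ^ (m - 1) * 2 := by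
        rw [← pow_succ, Nat.sub_add_cancel hm]
      have key := map_add (zsmulAddGroupHom ((2 : ℤ) ^ (m - 1)) : galH1Torsion (V.baseChange K) n →+ _)
        (y + conjAct V σ n y) (y - conjAct V σ n y)
      change (2 : ℤ) ^ (m - 1) • ((y + conjAct V σ n y) + (y - conjAct V σ n y)) =
        (2 : ℤ) ^ (m - 1) • (y + conjAct V σ n y) + (2 : ℤ) ^ (m - 1) • (y - conjAct V σ n y) at key
      rw [e, mul_smul, ← hsum, key, h, h', add_zero]
  · refine ⟨1, Or.inl rfl, ?_, ?_⟩
    · rw [one_zsmul]; exact hplus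
    · rw [one_zsmul]; exact h

end Symmetrise

end Summit.BirchSwinnertonDyer.BirchSwinnertonDyer.Theorems.KolyvaginLowerBoundAtTwo

end
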